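import Literature.Analysis.Complex.CircleHomomorphisms
import Mathlib.Analysis.SpecialFunctions.Pow.Complex
import Mathlib.Analysis.SpecialFunctions.Complex.Circle
import HarnessLib

/-!
# Continuous unitary characters of `ℝˣ` and `ℂˣ`: the parameters `(it, ε)` and `(it, k)`

Topic `Literature/Analysis/Complex`; namespace `Literature.Analysis.Complex`. Theorems only.
The classical description of the continuous unitary characters of the multiplicative groups of the
two archimedean local fields (Tate's thesis, §2.2–§2.3: "the quasi-characters of `kˣ` are
`c(α) = c̃(α̃) |α|^s` with `c̃` a character of the units `u = {±1}` resp. `S¹`", the characters of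
`S¹` being `e^{inθ}`; Booker–Krishnamurthy (2011), §1.1):

* `exists_cpow_mul_I_of_pos` — a continuous unitary character `χ` of `ℝˣ` is `x ↦ x^{it}` on the
  positive reals (`t ∈ ℝ`), from the tree's classification of the continuous unitary one-parameter
  groups `Literature.Analysis.Complex.exists_eq_exp_of_continuous_unitary_hom` applied to `s ↦ χ(e^s)`;
* `exists_sign_pow_mul_cpow_of_continuous_unitary_real` — **real case**:
  `χ(x) = sgn(x)^ε |x|^{it}` with `ε ∈ {0, 1}`, `t ∈ ℝ`;
* `exists_cpow_mul_zpow_of_continuous_unitary_complex` — **complex case**: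
  `χ(z) = |z|^{it} (z/|z|)^k` with `t ∈ ℝ`, `k ∈ ℤ` (the angular one-parameter group
  `θ ↦ χ(e^{iθ})` is `e^{ik'θ}` and `2π`-periodic, whence `k' ∈ ℤ`).

## References

* J. Tate, *Fourier analysis in number fields and Hecke's zeta-functions*, in Cassels–Fröhlich,
  *Algebraic Number Theory* (1967), Ch. XV, §2.2–§2.3 [TateThesis1967].
* A. Booker, M. Krishnamurthy, *A strengthening of the GL(2) converse theorem*, Compos. Math. 147
  (2011), §1.1 [BookerKrishnamurthy2011].
-/

noncomputable section

open Complex Real Set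

namespace Literature.Analysis.Complex

/-! ### The radial part: `χ(x) = x^{it}` for `x > 0` -/

/-- **Radial part of a continuous unitary character of `ℝˣ`**: there is `t ∈ ℝ` with
`χ(x) = x^{it}` for every unit `x > 0` (the one-parameter group `s ↦ χ(e^s)` is `e^{its}`).
[cite: TateThesis1967, Ch. XV §2.3] -/
theorem exists_cpow_mul_I_of_pos {χ : ℝˣ →* ℂˣ} (hχ : Continuous fun x => (χ x : ℂ))
    (hu : ∀ x, ‖(χ x : ℂ)‖ = 1) :
    ∃ t : ℝ, ∀ x : ℝˣ, 0 < (x : ℝ) → (χ x : ℂ) = ((x : ℝ) : ℂ) ^ ((t : ℂ) * I) := by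
  -- the one-parameter group `s ↦ e^s` of `ℝˣ`
  set expUnit : ℝ → ℝˣ := fun s => Units.mk0 (Real.exp s) (Real.exp_ne_zero s) with hexpUnit
  have expUnit_add : ∀ s t, expUnit (s + t) = expUnit s * expUnit t := fun s t =>
    Units.ext (by simp [hexpUnit, Real.exp_add])
  have continuous_expUnit : Continuous expUnit := by
    refine Units.continuous_iff.mpr ⟨Real.continuous_exp, ?_⟩
    simp only [hexpUnit, Units.val_inv_eq_inv_val, Units.val_mk0]
    exact Real.continuous_exp.inv₀ fun s => Real.exp_ne_zero s
  set f : ℝ → ℂ := fun s => (χ (expUnit s) : ℂ) with hf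
  have hfc : Continuous f := hχ.comp continuous_expUnit
  have hf1 : ∀ s, ‖f s‖ = 1 := fun s => hu _
  have hfmul : ∀ s t, f (s + t) = f s * f t := fun s t => by
    simp only [hf, expUnit_add, map_mul, Units.val_mul]
  obtain ⟨k, hk⟩ := exists_eq_exp_of_continuous_unitary_hom hfc hf1 hfmul
  refine ⟨k, fun x hx => ?_⟩
  have hxe : x = expUnit (Real.log x) := Units.ext (by simp [hexpUnit, Real.exp_log hx])
  have hx0 : ((x : ℝ) : ℂ) ≠ 0 := Complex.ofReal_ne_zero.mpr hx.ne'
  have hval : (χ x : ℂ) = f (Real.log x) := by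
    simp only [hf]
    rw [← hxe]
  rw [hval, hk, Complex.cpow_def_of_ne_zero hx0, ← Complex.ofReal_log hx.le]
  congr 1
  ring

/-! ### Real case -/

/-- **Continuous unitary characters of `ℝˣ`**: `χ(x) = sgn(x)^ε · |x|^{it}` with `ε ∈ {0, 1}` and
`t ∈ ℝ` (Tate: `c = c̃ · |·|^s`, `c̃` a character of `{±1}`). [cite: TateThesis1967, Ch. XV §2.3]
[cite: BookerKrishnamurthy2011, §1.1 (p. 672)] -/
theorem exists_sign_pow_mul_cpow_of_continuous_unitary_real {χ : ℝˣ →* ℂˣ}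
    (hχ : Continuous fun x => (χ x : ℂ)) (hu : ∀ x, ‖(χ x : ℂ)‖ = 1) :
    ∃ (ε : ℕ) (t : ℝ), ε ≤ 1 ∧ ∀ x : ℝˣ,
      (χ x : ℂ) = (SignType.sign (x : ℝ) : ℂ) ^ ε * (((|(x : ℝ)| : ℝ) : ℂ)) ^ ((t : ℂ) * I) := by
  obtain ⟨t, ht⟩ := exists_cpow_mul_I_of_pos hχ hu
  -- the unit `-1` and `χ(-1) = ±1`
  set m : ℝˣ := -1 with hm
  have hm2 : (χ m : ℂ) * (χ m : ℂ) = 1 := by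
    rw [← Units.val_mul, ← map_mul, hm, neg_mul_neg, one_mul, map_one, Units.val_one]
  have hεex : ∃ ε : ℕ, ε ≤ 1 ∧ (χ m : ℂ) = (-1 : ℂ) ^ ε := by
    rcases mul_self_eq_one_iff.mp hm2 with h | h
    · exact ⟨0, zero_le_one, by rw [h, pow_zero]⟩
    · exact ⟨1, le_rfl, by rw [h, pow_one]⟩
  obtain ⟨ε, hε1, hε⟩ := hεex
  refine ⟨ε, t, hε1, fun x => ?_⟩
  have hx0 : (x : ℝ) ≠ 0 := x.ne_zero
  -- the unit `|x|`
  set a : ℝˣ := Units.mk0 |(x : ℝ)| (abs_ne_zero.mpr hx0) with ha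
  have hapos : 0 < (a : ℝ) := abs_pos.mpr hx0
  rcases lt_or_gt_of_ne hx0 with hneg | hpos
  · -- `x = (-1) · |x|`
    have hx : x = m * a := Units.ext (by simp [hm, ha, abs_of_neg hneg])
    rw [hx, map_mul, Units.val_mul, ht a hapos, hε]
    simp only [ha, Units.val_mk0, hm, Units.val_neg, neg_mul, one_mul, abs_neg, abs_abs]
    rw [_root_.sign_neg (neg_neg_of_pos (abs_pos.mpr hx0)), SignType.coe_neg_one, mul_comm]
  · have hx : x = a := Units.ext (by simp [ha, abs_of_pos hpos])
    have hsign : (SignType.sign (x : ℝ) : ℂ) = 1 := by rw [_root_.sign_pos hpos, SignType.coe_one]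
    rw [hsign, one_pow, one_mul]
    conv_lhs => rw [hx]
    rw [ht a hapos]
    simp [ha]

/-! ### Complex case -/

/-- **Continuous unitary characters of `ℂˣ`**: `χ(z) = |z|^{it} · (z/|z|)^k` with `t ∈ ℝ` and
`k ∈ ℤ` (Tate: `c = c̃ · |·|^s` with `c̃(e^{iθ}) = e^{inθ}` a character of `S¹`; the angular
one-parameter group `θ ↦ χ(e^{iθ})` is `e^{ik'θ}` and `2π`-periodic, so `k' ∈ ℤ`).
[cite: TateThesis1967, Ch. XV §2.3] [cite: BookerKrishnamurthy2011, §1.1 (p. 672)] -/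
theorem exists_cpow_mul_zpow_of_continuous_unitary_complex {χ : ℂˣ →* ℂˣ}
    (hχ : Continuous fun z => (χ z : ℂ)) (hu : ∀ z, ‖(χ z : ℂ)‖ = 1) :
    ∃ (t : ℝ) (k : ℤ), ∀ z : ℂˣ,
      (χ z : ℂ) = ((‖(z : ℂ)‖ : ℂ)) ^ ((t : ℂ) * I) * ((z : ℂ) / (‖(z : ℂ)‖ : ℂ)) ^ k := by
  -- the units `e^{iθ}` and `r > 0` of `ℂ`
  set angUnit : ℝ → ℂˣ := fun θ => Units.mk0 (cexp (θ * I)) (Complex.exp_ne_zero _) with hangUnit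
  have angUnit_add : ∀ s u, angUnit (s + u) = angUnit s * angUnit u := fun s u =>
    Units.ext (by simp [hangUnit, add_mul, Complex.exp_add])
  have continuous_angUnit : Continuous angUnit := by
    have hc : Continuous fun θ : ℝ => cexp (θ * I) :=
      Complex.continuous_exp.comp (Complex.continuous_ofReal.mul continuous_const)
    refine Units.continuous_iff.mpr ⟨hc, ?_⟩
    simp only [hangUnit, Units.val_inv_eq_inv_val, Units.val_mk0]
    exact hc.inv₀ fun θ => Complex.exp_ne_zero _
  set posUnit : ∀ r : ℝ, 0 < r → ℂˣ := fun r hr => Units.mk0 (r : ℂ) (Complex.ofReal_ne_zero.mpr hr.ne')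
    with hposUnit
  -- radial one-parameter group
  set fr : ℝ → ℂ := fun s => (χ (posUnit (Real.exp s) (Real.exp_pos s)) : ℂ) with hfr
  have hu_cont : Continuous fun s : ℝ => posUnit (Real.exp s) (Real.exp_pos s) := by
    refine Units.continuous_iff.mpr ⟨Complex.continuous_ofReal.comp Real.continuous_exp, ?_⟩
    simp only [hposUnit, Units.val_inv_eq_inv_val, Units.val_mk0]
    exact (Complex.continuous_ofReal.comp Real.continuous_exp).inv₀ fun s =>
      Complex.ofReal_ne_zero.mpr (Real.exp_pos s).ne'
  have hfrc : Continuous fr := hχ.comp hu_cont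
  have hfr1 : ∀ s, ‖fr s‖ = 1 := fun s => hu _
  have hfrmul : ∀ s t, fr (s + t) = fr s * fr t := fun s t => by
    have h : posUnit (Real.exp (s + t)) (Real.exp_pos _) =
        posUnit (Real.exp s) (Real.exp_pos s) * posUnit (Real.exp t) (Real.exp_pos t) :=
      Units.ext (by simp [hposUnit, Real.exp_add])
    simp only [hfr, h, map_mul, Units.val_mul]
  obtain ⟨t, ht⟩ := exists_eq_exp_of_continuous_unitary_hom hfrc hfr1 hfrmul
  -- angular one-parameter group
  set fa : ℝ → ℂ := fun θ => (χ (angUnit θ) : ℂ) with hfa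
  have hfac : Continuous fa := hχ.comp continuous_angUnit
  have hfa1 : ∀ θ, ‖fa θ‖ = 1 := fun θ => hu _
  have hfamul : ∀ s u, fa (s + u) = fa s * fa u := fun s u => by
    simp only [hfa, angUnit_add, map_mul, Units.val_mul]
  obtain ⟨k', hk'⟩ := exists_eq_exp_of_continuous_unitary_hom hfac hfa1 hfamul
  -- `2π`-periodicity forces `k' ∈ ℤ`
  have h2π : angUnit (2 * π) = 1 := Units.ext (by
    simp only [hangUnit, Units.val_mk0, Units.val_one]
    rw [show ((2 * π : ℝ) : ℂ) * I = 2 * π * I by push_cast; ring, Complex.exp_two_pi_mul_I])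
  have hk'int : ∃ k : ℤ, (k' : ℂ) = k := by
    have h1 : fa (2 * π) = 1 := by simp only [hfa, h2π, map_one, Units.val_one]
    rw [hk'] at h1
    obtain ⟨n, hn⟩ := Complex.exp_eq_one_iff.mp h1
    refine ⟨n, ?_⟩
    have h2 : (k' : ℂ) * (2 * π * I) = n * (2 * π * I) := by rw [← hn]; push_cast; ring
    have hne : (2 * π * I : ℂ) ≠ 0 := by
      simp [Real.pi_ne_zero, Complex.I_ne_zero]
    exact mul_right_cancel₀ hne h2
  obtain ⟨k, hk⟩ := hk'int
  refine ⟨t, k, fun z => ?_⟩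
  have hz0 : (z : ℂ) ≠ 0 := z.ne_zero
  have hnpos : 0 < ‖(z : ℂ)‖ := norm_pos_iff.mpr hz0
  have hn0 : ((‖(z : ℂ)‖ : ℂ)) ≠ 0 := Complex.ofReal_ne_zero.mpr hnpos.ne'
  -- `z = |z| · e^{i arg z}`
  have hz : z = posUnit ‖(z : ℂ)‖ hnpos * angUnit (Complex.arg z) := Units.ext (by
    simp only [hposUnit, hangUnit, Units.val_mul, Units.val_mk0]
    exact (Complex.norm_mul_exp_arg_mul_I (z : ℂ)).symm)
  have hrad : (χ (posUnit ‖(z : ℂ)‖ hnpos) : ℂ) = ((‖(z : ℂ)‖ : ℂ)) ^ ((t : ℂ) * I) := by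
    have h : posUnit ‖(z : ℂ)‖ hnpos = posUnit (Real.exp (Real.log ‖(z : ℂ)‖)) (Real.exp_pos _) :=
      Units.ext (by simp [hposUnit, Real.exp_log hnpos])
    rw [h, show (χ (posUnit (Real.exp (Real.log ‖(z : ℂ)‖)) (Real.exp_pos _)) : ℂ) = fr (Real.log ‖(z : ℂ)‖)
      from rfl, ht, Complex.cpow_def_of_ne_zero hn0, ← Complex.ofReal_log hnpos.le]
    congr 1
    ring
  have hang : (χ (angUnit (Complex.arg z)) : ℂ) = ((z : ℂ) / (‖(z : ℂ)‖ : ℂ)) ^ k := by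
    rw [show (χ (angUnit (Complex.arg z)) : ℂ) = fa (Complex.arg z) from rfl, hk', hk,
      show (k : ℂ) * (Complex.arg z : ℂ) * I = k * ((Complex.arg z : ℂ) * I) by ring,
      Complex.exp_int_mul]
    congr 1
    rw [eq_div_iff hn0, mul_comm]
    exact Complex.norm_mul_exp_arg_mul_I (z : ℂ)
  conv_lhs => rw [hz]
  rw [map_mul, Units.val_mul, hrad, hang]

end Literature.Analysis.Complex
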